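import Literature.Analysis.Calculus.NewtonSplitThreeFormal
import Literature.Analysis.Calculus.NewtonSymmetricTwo
import HarnessLib

/-!
# The split smooth Newton theorem `S₂ ⊂ S₃` (smooth preparation of the split chart at a scalar corner)

Topic `Analysis/Calculus`; cell `pub/hodgecm-mathlib`, N8-INNER brick (10)(A′) «SPLIT NEWTON `S₂ ⊂ S₃`» (sigsheet
`SIGSHEET-NewtonSplitThree.v1`, file F3).  Count-neutral Literature THEOREMS (`--kind proof --supports
stmt-HodgeConjecture-24833`); no `def`, no instance, no notation, no `sorry`; frame of ★ `GlaeserSymmetricThree`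
(one universe; parameters `P` finite-dimensional; values in a complete real normed space `E`).

THE THEOREM (eigen-angle form, `exists_contDiff_newtonSplitThree`).  For a smooth `g (x, θ, θ′, z)` EVEN in `x` there are
smooth `U₀, U₁, U₂` with `g (x, θ, θ′, z) = Σ_{k<3} θ′^k • U_k (e₁, e₂, e₃, z)`, where `e₁ = 2θ + θ′`, `e₂ = θ² + x² + 2θθ′`,
`e₃ = (θ² + x²)θ′` are the (real) elementary symmetric polynomials of the triple `(θ + ix, θ′, θ − ix)`.  This is the
smooth Newton∕Glaeser theorem for the pair `S₂ ⊂ S₃` on the SPLIT real form (one complex-conjugate pair of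
eigen-parameters): the `x`-even smooth germs form the `C^∞(e)`-module generated by `1, θ′, θ′²`.  Light-cone normal
form (`exists_contDiff_comp_splitInvariants_of_swap`): a smooth `Φ (p, q, z)` symmetric in `(p, q)` is
`Σ_{k<3} (p+q)^k • G_k (pq, (p³+q³)/2, z)` — with `p, q = (θ′−θ) ± √3·x`, `e₁` a parameter, `pq = e₁² − 3e₂`,
`(p³+q³)/2 = (27e₃ − 9e₁e₂ + 2e₁³)/2`, `p + q = 3θ′ − e₁`.

ROAD (Whitney 1943 «formal + flat», along the whole axis `pq = 0`).  ★ `NewtonSymmetricTwo`: `Φ (p,q,z) = H (pq, p+q, z)`;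
★ `NewtonSplitThreeFormal` (F2): smooth `G_k (u, v, z)` with `H (u, t, z) − Σ_k t^k • G_k (u, (t³−3ut)/2, z)` flat along
`u = 0` — and `((p+q)³ − 3pq(p+q))/2 = (p³+q³)/2`; so the remainder `Φ′ (p, q, z)` is symmetric and flat along BOTH axes
`q = 0`, `p = 0`; §1 (`exists_contDiff_comp_splitInvariants_of_flat`): by the flat real cube-root descent (★ F1
`FlatCubeRootDescentReal`) in `q`, then in `p`, `Φ′ (p, q, z) = Ψ (p³, q³, z)` with `Ψ` smooth and symmetric, hence
(★ `NewtonSymmetricTwo`) `Ψ = Ξ (p³+q³, p³q³, z) = Ξ (2v, u³, z)`.  No cusp or Whitney-extension analysis.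
HONEST LABEL: count-neutral Mathlib-side analysis; HC_CM is proved only modulo the printed citations (hLiu418 =
`stmt-HodgeConjecture-24832`, h413 = `stmt-HodgeConjecture-24833`) until rung 0 closes.

## References
* [Glaeser1963Newton] G. Glaeser, *Fonctions composées différentiables*, Ann. of Math. 77 (1963) 193–209, Thm. II
  (the differentiable Newton theorem; here its `S₂ ⊂ S₃` module form on the split real form).
* [Whitney1943] H. Whitney, *Differentiable even functions*, Duke Math. J. 10 (1943) 159–160 («formal + flat»).
* [HormanderALPDO1] L. Hörmander, *The Analysis of Linear Partial Differential Operators I*, §1.1–1.2.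
-/

noncomputable section

open Set Function Filter Topology Finset Asymptotics
open scoped ContDiff Nat

namespace Literature.Analysis.Calculus

universe u

variable {P : Type u} [NormedAddCommGroup P] [NormedSpace ℝ P] [FiniteDimensional ℝ P]
  {E : Type u} [NormedAddCommGroup E] [NormedSpace ℝ E] [CompleteSpace E]

/-! ## §0 A continuous real cube root -/

omit [FiniteDimensional ℝ P] [CompleteSpace E] in
/-- A continuous real cube root: `c` continuous with `(c Q)³ = Q` and `c (s³) = s` (the inverse of the strictly
monotone homeomorphism `s ↦ s³` of `ℝ`). [folklore] [cite: Whitney1943, Thm. 1] -/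
theorem exists_continuous_cubeRoot :
    ∃ c : ℝ → ℝ, Continuous c ∧ (∀ Q : ℝ, c Q ^ 3 = Q) ∧ ∀ s : ℝ, c (s ^ 3) = s := by
  have hmono : StrictMono fun s : ℝ => s ^ 3 := Odd.strictMono_pow (by decide : Odd 3)
  have hsurj : Function.Surjective fun s : ℝ => s ^ 3 := fun Q => exists_pow_three_eq Q
  set e : ℝ ≃o ℝ := hmono.orderIsoOfSurjective _ hsurj with he
  refine ⟨e.symm, e.symm.continuous, fun Q => ?_, fun s => ?_⟩
  · exact e.apply_symm_apply Q
  · exact e.symm_apply_apply s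

/-! ## §1 The flat part: symmetric functions flat along the axes -/

/-- **Flat part of the split Newton theorem.** A smooth `Φ (p, q, z)`, symmetric in `(p, q)` and flat along the axis
`q = 0` (value currency, locally uniformly), is a smooth function of the split invariants:
`Φ (p, q, z) = G (pq, (p³ + q³)/2, z)` with `G` smooth on all of `ℝ × ℝ × P`.  (Cube descent in `q`, then in `p`
— ★ `exists_contDiff_comp_pow_three_of_isBigO` — then ★ `NewtonSymmetricTwo` on `Ψ (p³, q³, z)`.)
[folklore] [cite: Whitney1943, Thm. 1] [cite: Glaeser1963Newton, Thm. II] -/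
theorem exists_contDiff_comp_splitInvariants_of_flat (Φ : ℝ × ℝ × P → E) (hΦ : ContDiff ℝ ∞ Φ)
    (hswap : ∀ (p q : ℝ) (z : P), Φ (q, p, z) = Φ (p, q, z))
    (hflat : ∀ (N : ℕ) (p₀ : ℝ) (z₀ : P),
      Φ =O[𝓝 ((p₀, 0, z₀) : ℝ × ℝ × P)] fun x : ℝ × ℝ × P => ‖x.2.1‖ ^ N) :
    ∃ G : ℝ × ℝ × P → E, ContDiff ℝ ∞ G ∧
      ∀ (p q : ℝ) (z : P), Φ (p, q, z) = G (p * q, (p ^ 3 + q ^ 3) / 2, z) := by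
  obtain ⟨c, hcc, hc3, hc3'⟩ := exists_continuous_cubeRoot
  -- step 1: descent in `q` (the variable `q` first, parameter `(p, z)`)
  set Φ₁ : ℝ × (ℝ × P) → E := fun w => Φ (w.2.1, w.1, w.2.2) with hΦ₁
  have hΦ₁s : ContDiff ℝ ∞ Φ₁ :=
    hΦ.comp ((contDiff_fst.comp contDiff_snd).prodMk (contDiff_fst.prodMk (contDiff_snd.comp contDiff_snd)))
  have hΦ₁flat : ∀ (N : ℕ) (y : ℝ × P), Φ₁ =O[𝓝 ((0 : ℝ), y)] fun w : ℝ × (ℝ × P) => ‖w.1‖ ^ N := by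
    rintro N ⟨p₀, z₀⟩
    have hT : Tendsto (fun w : ℝ × (ℝ × P) => ((w.2.1, w.1, w.2.2) : ℝ × ℝ × P)) (𝓝 ((0 : ℝ), (p₀, z₀)))
        (𝓝 ((p₀, 0, z₀) : ℝ × ℝ × P)) := by
      have hcont : Continuous fun w : ℝ × (ℝ × P) => ((w.2.1, w.1, w.2.2) : ℝ × ℝ × P) := by fun_prop
      simpa using hcont.tendsto ((0 : ℝ), (p₀, z₀))
    exact (hflat N p₀ z₀).comp_tendsto hT
  obtain ⟨G₁, hG₁s, -, hG₁⟩ := exists_contDiff_comp_pow_three_of_isBigO Φ₁ hΦ₁s hΦ₁flat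
  -- so `Φ (p, q, z) = G₁ (q³, (p, z))`
  have hΦG₁ : ∀ (p q : ℝ) (z : P), Φ (p, q, z) = G₁ (q ^ 3, (p, z)) := fun p q z => hG₁ q (p, z)
  -- step 2: descent in `p` (parameter `(Q, z)`)
  set Ψ₁ : ℝ × (ℝ × P) → E := fun w => G₁ (w.2.1, (w.1, w.2.2)) with hΨ₁
  have hΨ₁s : ContDiff ℝ ∞ Ψ₁ :=
    hG₁s.comp ((contDiff_fst.comp contDiff_snd).prodMk (contDiff_fst.prodMk (contDiff_snd.comp contDiff_snd)))
  have hΨ₁val : ∀ (p Q : ℝ) (z : P), Ψ₁ (p, (Q, z)) = Φ (c Q, p, z) := by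
    intro p Q z
    simp only [hΨ₁]
    rw [hswap, hΦG₁ p (c Q) z, hc3 Q]
  have hΨ₁flat : ∀ (N : ℕ) (y : ℝ × P), Ψ₁ =O[𝓝 ((0 : ℝ), y)] fun w : ℝ × (ℝ × P) => ‖w.1‖ ^ N := by
    rintro N ⟨Q₀, z₀⟩
    -- `Ψ₁ (p, (Q, z)) = Φ (c Q, p, z) = Φ₁ (p, (c Q, z))`, and `Φ₁` is flat along `p = 0`
    have hT : Tendsto (fun w : ℝ × (ℝ × P) => ((w.1, (c w.2.1, w.2.2)) : ℝ × (ℝ × P))) (𝓝 ((0 : ℝ), (Q₀, z₀)))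
        (𝓝 ((0 : ℝ), (c Q₀, z₀))) := by
      have hcont : Continuous fun w : ℝ × (ℝ × P) => ((w.1, (c w.2.1, w.2.2)) : ℝ × (ℝ × P)) := by fun_prop
      simpa using hcont.tendsto ((0 : ℝ), (Q₀, z₀))
    refine ((hΦ₁flat N (c Q₀, z₀)).comp_tendsto hT).congr_left fun w => ?_
    simp only [Function.comp_apply, hΦ₁]
    exact (hΨ₁val w.1 w.2.1 w.2.2).symm
  obtain ⟨G₂, hG₂s, -, hG₂⟩ := exists_contDiff_comp_pow_three_of_isBigO Ψ₁ hΨ₁s hΨ₁flat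
  have hΦG₂ : ∀ (p q : ℝ) (z : P), Φ (p, q, z) = G₂ (p ^ 3, (q ^ 3, z)) := by
    intro p q z
    rw [hΦG₁, show G₁ (q ^ 3, (p, z)) = Ψ₁ (p, (q ^ 3, z)) from rfl, hG₂]
  -- step 3: `Ψ (P, Q, z) := G₂ (P, (Q, z))` is symmetric (cubes are onto); Newton for `S₂`
  set f : (Fin 2 → ℝ) × P → E := fun w => G₂ (w.1 0, (w.1 1, w.2)) with hf
  have hfs : ContDiff ℝ ∞ f := by
    have h0 : ContDiff ℝ ∞ fun w : (Fin 2 → ℝ) × P => w.1 0 := (contDiff_apply ℝ ℝ (0 : Fin 2)).comp contDiff_fst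
    have h1 : ContDiff ℝ ∞ fun w : (Fin 2 → ℝ) × P => w.1 1 := (contDiff_apply ℝ ℝ (1 : Fin 2)).comp contDiff_fst
    exact hG₂s.comp (h0.prodMk (h1.prodMk contDiff_snd))
  have hfsymm : ∀ (x : Fin 2 → ℝ) (z : P), f (![x 1, x 0], z) = f (x, z) := by
    intro x z
    simp only [hf, Matrix.cons_val_zero, Matrix.cons_val_one]
    rw [← hc3 (x 0), ← hc3 (x 1), ← hΦG₂, ← hΦG₂, hswap]
  obtain ⟨g, hgs, hg⟩ := exists_contDiff_comp_esymm_two_of_swap f hfs hfsymm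
  -- `G (u, v, z) := g (![2v, u³], z)`
  refine ⟨fun q => g (![2 * q.2.1, q.1 ^ 3], q.2.2), ?_, fun p q z => ?_⟩
  · refine hgs.comp (ContDiff.prodMk ?_ (contDiff_snd.comp contDiff_snd))
    refine contDiff_pi.2 fun i => ?_
    fin_cases i
    · exact contDiff_const.mul (contDiff_fst.comp contDiff_snd)
    · exact contDiff_fst.pow 3
  · have h1 : Φ (p, q, z) = f (![p ^ 3, q ^ 3], z) := by
      simp only [hf, Matrix.cons_val_zero, Matrix.cons_val_one]
      exact hΦG₂ p q z
    rw [h1, hg]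
    simp only [Matrix.cons_val_zero, Matrix.cons_val_one]
    congr 2
    funext i
    fin_cases i
    · simp; ring
    · simp; ring

/-! ## §2 The light-cone normal form -/

/-- **Split smooth Newton theorem, light-cone form.** A smooth `Φ (p, q, z)` symmetric in `(p, q)` is
`Σ_{k<3} (p+q)^k • G_k (pq, (p³+q³)/2, z)` with `G₀, G₁, G₂` smooth on all of `ℝ × ℝ × P`.  (★ `NewtonSymmetricTwo`
⇒ `Φ = H (pq, p+q, ·)`; ★ formal part F2 along the axis with the cusp substitution `v = (t³−3ut)/2 = (p³+q³)/2`; §1 on the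
flat remainder.) [folklore] [cite: Glaeser1963Newton, Thm. II] [cite: Whitney1943, Thm. 1] -/
theorem exists_contDiff_comp_splitInvariants_of_swap (Φ : ℝ × ℝ × P → E) (hΦ : ContDiff ℝ ∞ Φ)
    (hswap : ∀ (p q : ℝ) (z : P), Φ (q, p, z) = Φ (p, q, z)) :
    ∃ G : Fin 3 → ℝ × ℝ × P → E, (∀ k, ContDiff ℝ ∞ (G k)) ∧
      ∀ (p q : ℝ) (z : P), Φ (p, q, z) = ∑ k : Fin 3, (p + q) ^ (k : ℕ) • G k (p * q, (p ^ 3 + q ^ 3) / 2, z) := by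
  -- Newton for `S₂`: `Φ (p, q, z) = H (pq, p+q, z)`
  set f : (Fin 2 → ℝ) × P → E := fun w => Φ (w.1 0, w.1 1, w.2) with hf
  have hfs : ContDiff ℝ ∞ f := by
    have h0 : ContDiff ℝ ∞ fun w : (Fin 2 → ℝ) × P => w.1 0 := (contDiff_apply ℝ ℝ (0 : Fin 2)).comp contDiff_fst
    have h1 : ContDiff ℝ ∞ fun w : (Fin 2 → ℝ) × P => w.1 1 := (contDiff_apply ℝ ℝ (1 : Fin 2)).comp contDiff_fst
    exact hΦ.comp (h0.prodMk (h1.prodMk contDiff_snd))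
  have hfsymm : ∀ (x : Fin 2 → ℝ) (z : P), f (![x 1, x 0], z) = f (x, z) := by
    intro x z
    simp only [hf, Matrix.cons_val_zero, Matrix.cons_val_one]
    exact hswap _ _ _
  obtain ⟨g, hgs, hg⟩ := exists_contDiff_comp_esymm_two_of_swap f hfs hfsymm
  set H : ℝ × ℝ × P → E := fun q => g (![q.2.1, q.1], q.2.2) with hH
  have hHs : ContDiff ℝ ∞ H := by
    refine hgs.comp (ContDiff.prodMk ?_ (contDiff_snd.comp contDiff_snd))
    refine contDiff_pi.2 fun i => ?_
    fin_cases i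
    · exact contDiff_fst.comp contDiff_snd
    · exact contDiff_fst
  have hΦH : ∀ (p q : ℝ) (z : P), Φ (p, q, z) = H (p * q, p + q, z) := by
    intro p q z
    have h1 : Φ (p, q, z) = f (![p, q], z) := by
      simp only [hf, Matrix.cons_val_zero, Matrix.cons_val_one]
    rw [h1, hg]
    simp only [hH, Matrix.cons_val_zero, Matrix.cons_val_one]
  -- formal part along the axis
  obtain ⟨G, hGs, hGflat⟩ := exists_contDiff_sub_sum_pow_smul_comp_cusp_isBigO H hHs
  -- the remainder in `(p, q)` coordinates
  set Φ' : ℝ × ℝ × P → E := fun x => Φ x -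
      ∑ k : Fin 3, (x.1 + x.2.1) ^ (k : ℕ) • G k (x.1 * x.2.1, (x.1 ^ 3 + x.2.1 ^ 3) / 2, x.2.2) with hΦ'
  have hΦ's : ContDiff ℝ ∞ Φ' := by
    refine hΦ.sub (ContDiff.sum fun k _ => ((contDiff_fst.add (contDiff_fst.comp contDiff_snd)).pow _).smul ?_)
    exact (hGs k).comp ((contDiff_fst.mul (contDiff_fst.comp contDiff_snd)).prodMk
      ((((contDiff_fst.pow 3).add ((contDiff_fst.comp contDiff_snd).pow 3)).div_const 2).prodMk
        (contDiff_snd.comp contDiff_snd)))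
  have hΦ'swap : ∀ (p q : ℝ) (z : P), Φ' (q, p, z) = Φ' (p, q, z) := by
    intro p q z
    simp only [hΦ']
    rw [hswap, mul_comm q p, add_comm q p, add_comm (q ^ 3) (p ^ 3)]
  have hΦ'R : ∀ (p q : ℝ) (z : P), Φ' (p, q, z) = H (p * q, p + q, z) -
      ∑ k : Fin 3, (p + q) ^ (k : ℕ) • G k (p * q, ((p + q) ^ 3 - 3 * (p * q) * (p + q)) / 2, z) := by
    intro p q z
    simp only [hΦ', hΦH]
    congr 1
    refine Finset.sum_congr rfl fun k _ => ?_
    congr 3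
    ring
  have hΦ'flat : ∀ (N : ℕ) (p₀ : ℝ) (z₀ : P),
      Φ' =O[𝓝 ((p₀, 0, z₀) : ℝ × ℝ × P)] fun x : ℝ × ℝ × P => ‖x.2.1‖ ^ N := by
    intro N p₀ z₀
    have hT : Tendsto (fun x : ℝ × ℝ × P => ((x.1 * x.2.1, x.1 + x.2.1, x.2.2) : ℝ × ℝ × P))
        (𝓝 ((p₀, 0, z₀) : ℝ × ℝ × P)) (𝓝 ((0, p₀, z₀) : ℝ × ℝ × P)) := by
      have hcont : Continuous fun x : ℝ × ℝ × P => ((x.1 * x.2.1, x.1 + x.2.1, x.2.2) : ℝ × ℝ × P) := by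
        fun_prop
      simpa using hcont.tendsto ((p₀, 0, z₀) : ℝ × ℝ × P)
    have h1 := (hGflat p₀ z₀ N).comp_tendsto hT
    have h2 : (fun x : ℝ × ℝ × P => Φ' x) =O[𝓝 ((p₀, 0, z₀) : ℝ × ℝ × P)]
        fun x : ℝ × ℝ × P => ‖x.1 * x.2.1‖ ^ N := by
      refine h1.congr_left fun x => ?_
      simp only [Function.comp_apply]
      exact (hΦ'R x.1 x.2.1 x.2.2).symm
    -- `|p q|^N ≤ C |q|^N` near `p₀`
    have h3 : (fun x : ℝ × ℝ × P => ‖x.1 * x.2.1‖ ^ N) =O[𝓝 ((p₀, 0, z₀) : ℝ × ℝ × P)]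
        fun x : ℝ × ℝ × P => ‖x.2.1‖ ^ N := by
      have hc : Continuous fun x : ℝ × ℝ × P => ‖x.1‖ ^ N := (continuous_fst.norm).pow _
      have h4 : (fun x : ℝ × ℝ × P => ‖x.1‖ ^ N) =O[𝓝 ((p₀, 0, z₀) : ℝ × ℝ × P)] fun _ => (1 : ℝ) :=
        (hc.tendsto _).isBigO_one ℝ
      have h5 := h4.mul (isBigO_refl (fun x : ℝ × ℝ × P => ‖x.2.1‖ ^ N) (𝓝 ((p₀, 0, z₀) : ℝ × ℝ × P)))
      simp only [one_mul] at h5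
      refine (IsBigO.of_bound 1 (Eventually.of_forall fun x => ?_)).trans h5
      rw [norm_mul, mul_pow, one_mul]
    exact h2.trans h3
  obtain ⟨G', hG's, hG'⟩ := exists_contDiff_comp_splitInvariants_of_flat Φ' hΦ's hΦ'swap hΦ'flat
  -- assemble: absorb `G'` into `G 0`
  refine ⟨fun k => if (k : ℕ) = 0 then (fun q => G 0 q + G' q) else G k, fun k => ?_, fun p q z => ?_⟩
  · by_cases hk : (k : ℕ) = 0
    · simp only [hk, ↓reduceIte]; exact (hGs 0).add hG's
    · simp only [hk, ↓reduceIte]; exact hGs k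
  · have h := hG' p q z
    simp only [hΦ'] at h
    rw [Fin.sum_univ_three] at h ⊢
    simp only [Fin.isValue, Fin.val_zero, pow_zero, one_smul, Fin.val_one, pow_one, Fin.val_two,
      ↓reduceIte, Nat.one_ne_zero, OfNat.ofNat_ne_zero, smul_add] at h ⊢
    rw [← h]
    abel

/-! ## §3 The eigen-angle form -/

/-- **Split smooth Newton theorem `S₂ ⊂ S₃`, eigen-angle form.**  For a smooth `g (x, θ, θ′, z)` even in `x` there are
smooth `U₀, U₁, U₂` with `g (x, θ, θ′, z) = Σ_{k<3} θ′^k • U_k (e₁, e₂, e₃, z)` where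
`(e₁, e₂, e₃) = (2θ + θ′, θ² + x² + 2θθ′, (θ² + x²)θ′)` are the elementary symmetric polynomials of the triple
`(θ + ix, θ′, θ − ix)` — the `x`-even smooth functions are the `C^∞(e₁,e₂,e₃)`-span of `1, θ′, θ′²`.  From the light-cone
form with `p, q = (θ′−θ) ± √3·x`, `e₁` carried as a parameter: `pq = e₁² − 3e₂`, `(p³+q³)/2 = (27e₃ − 9e₁e₂ + 2e₁³)/2`,
`p + q = 3θ′ − e₁`. [folklore] [cite: Glaeser1963Newton, Thm. II] [cite: Whitney1943, Thm. 1] -/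
theorem exists_contDiff_newtonSplitThree (g : ℝ × ℝ × ℝ × P → E) (hg : ContDiff ℝ ∞ g)
    (heven : ∀ (x θ θ' : ℝ) (z : P), g (-x, θ, θ', z) = g (x, θ, θ', z)) :
    ∃ U : Fin 3 → ℝ × ℝ × ℝ × P → E, (∀ k, ContDiff ℝ ∞ (U k)) ∧
      ∀ (x θ θ' : ℝ) (z : P), g (x, θ, θ', z) =
        ∑ k : Fin 3, θ' ^ (k : ℕ) • U k (2 * θ + θ', θ ^ 2 + x ^ 2 + 2 * θ * θ', (θ ^ 2 + x ^ 2) * θ', z) := by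
  have h3 : Real.sqrt 3 * Real.sqrt 3 = 3 := Real.mul_self_sqrt (by norm_num)
  -- the light-cone frame: `x = (p − q)/(2√3)`, `θ = (m − (p+q)/2)/3`, `θ′ = (m + (p+q))/3`, parameter `(m, z)`
  set Φ : ℝ × ℝ × (ℝ × P) → E := fun w =>
    g ((w.1 - w.2.1) / (2 * Real.sqrt 3), (w.2.2.1 - (w.1 + w.2.1) / 2) / 3, (w.2.2.1 + (w.1 + w.2.1)) / 3, w.2.2.2)
    with hΦ
  have hΦs : ContDiff ℝ ∞ Φ := by
    refine hg.comp ?_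
    fun_prop
  have hΦswap : ∀ (p q : ℝ) (y : ℝ × P), Φ (q, p, y) = Φ (p, q, y) := by
    rintro p q ⟨m, z⟩
    simp only [hΦ]
    rw [show (q - p) / (2 * Real.sqrt 3) = -((p - q) / (2 * Real.sqrt 3)) by ring, heven, add_comm q p]
  obtain ⟨G, hGs, hG⟩ := exists_contDiff_comp_splitInvariants_of_swap Φ hΦs hΦswap
  -- the invariants in terms of `e = (e₁, e₂, e₃)`: arguments `(e₁² − 3e₂, (27e₃ − 9e₁e₂ + 2e₁³)/2, (e₁, z))`
  set A : ℝ × ℝ × ℝ × P → ℝ × ℝ × (ℝ × P) := fun e =>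
    (e.1 ^ 2 - 3 * e.2.1, (27 * e.2.2.1 - 9 * e.1 * e.2.1 + 2 * e.1 ^ 3) / 2, (e.1, e.2.2.2)) with hA
  have hAs : ContDiff ℝ ∞ A := by simp only [hA]; fun_prop
  refine ⟨![fun e => G 0 (A e) - e.1 • G 1 (A e) + e.1 ^ 2 • G 2 (A e),
      fun e => (3 : ℝ) • G 1 (A e) - (6 * e.1) • G 2 (A e),
      fun e => (9 : ℝ) • G 2 (A e)], fun k => ?_, fun x θ θ' z => ?_⟩
  · fin_cases k
    · simp only [Fin.zero_eta, Matrix.cons_val_zero]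
      exact (((hGs 0).comp hAs).sub (contDiff_fst.smul ((hGs 1).comp hAs))).add
        ((contDiff_fst.pow 2).smul ((hGs 2).comp hAs))
    · simp only [Fin.mk_one, Matrix.cons_val_one]
      exact (contDiff_const.smul ((hGs 1).comp hAs)).sub ((contDiff_const.mul contDiff_fst).smul
        ((hGs 2).comp hAs))
    · simp only [Fin.reduceFinMk, Matrix.cons_val]
      exact contDiff_const.smul ((hGs 2).comp hAs)
  · -- evaluate the light-cone form at `p, q = (θ′−θ) ± √3 x`, `m = 2θ + θ′`
    set p : ℝ := (θ' - θ) + Real.sqrt 3 * x with hp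
    set q : ℝ := (θ' - θ) - Real.sqrt 3 * x with hq
    set m : ℝ := 2 * θ + θ' with hm
    have hx : (p - q) / (2 * Real.sqrt 3) = x := by
      rw [hp, hq]
      have : Real.sqrt 3 ≠ 0 := by positivity
      field_simp
      ring
    have hθ : (m - (p + q) / 2) / 3 = θ := by rw [hp, hq, hm]; ring
    have hθ' : (m + (p + q)) / 3 = θ' := by rw [hp, hq, hm]; ring
    have hgΦ : g (x, θ, θ', z) = Φ (p, q, (m, z)) := by
      simp only [hΦ, hx, hθ, hθ']
    have hargs : ((p * q, (p ^ 3 + q ^ 3) / 2, (m, z)) : ℝ × ℝ × (ℝ × P)) =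
        A (2 * θ + θ', θ ^ 2 + x ^ 2 + 2 * θ * θ', (θ ^ 2 + x ^ 2) * θ', z) := by
      simp only [hA, hp, hq, hm, Prod.mk.injEq]
      refine ⟨?_, ?_, trivial⟩
      · linear_combination (-(x ^ 2)) * h3
      · linear_combination (3 * (θ' - θ) * x ^ 2) * h3
    have hpq : p + q = 3 * θ' - m := by rw [hp, hq, hm]; ring
    rw [hgΦ, hG p q (m, z), hargs, hpq, Fin.sum_univ_three, Fin.sum_univ_three]
    simp only [Fin.isValue, Fin.val_zero, pow_zero, one_smul, Fin.val_one, pow_one, Fin.val_two,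
      Matrix.cons_val_zero, Matrix.cons_val_one, Matrix.head_cons, Matrix.cons_val_two, Matrix.tail_cons,
      smul_add, smul_sub, smul_smul, hm]
    module

end Literature.Analysis.Calculus

end
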